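import Summits.BirchSwinnertonDyer.Rank1Residual.Additive.EisensteinMultipleEveryCusp
import Summits.BirchSwinnertonDyer.Rank1Residual.GaloisImage.EisensteinPrimeInProgression
import HarnessLib

/-!
# BSD rank-≤1 residual cell: every modular symbol `[r]⁺_f` is `p`-integral when `p` is odd and
# `E[p]` is irreducible (Drinfeld's operator `T_ℓ − ℓ − 1`, `ℓ ≡ 1 (mod N)`, at every cusp)

HONEST FRAMING (cell `b2b-bsdres-*`, run/shared/lean/b2b/bsd-rank1-residual/, verbatim): the goal
of the cell is to DELETE the COMBINATION-SHAPED residual classes for ALL analytic-rank `≤ 1` elliptic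
curves over `ℚ` — "full BSD formula for every rank `≤ 1` curve in class C" assembled STRICTLY from
published theorems — so that the rank-`≤ 1` remainder becomes exactly the CONSTRUCTION-SHAPED
classes, which are TYPED (missing-input Props), NOT attempted; this is not "finishing BSD".
Prove what is provable now; shrink each hard class to its core with data; no claim beyond stated
classes.  Research routes; census output = EVIDENCE, never a Literature fact.  Unit
`b2b-bsdres-n1011-p09` (team n1011, ROUTE-1 sub-target R1-8 (ii), OWNERS row **T-R18b**, step S-C of
`cells/n1011/skel/T-R18b.md`).  THEOREMS ONLY (no definition, no named fact, no instance); a TOOL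
file about modular symbols — no closure value, no class theorem, no label moves.

## What this file does (ROUTE-1 §15.1 F-d v2 (iii), §15.4 R1-8 (ii) — as a KERNEL THEOREM)

For an elliptic curve `E = W/ℚ` (globally minimal), an ODD prime `p` with `E[p]` IRREDUCIBLE, and
`f ∈ S₂(Γ₀(N))` the newform of `E` (`IsNewformOf W f`; no hypothesis on `N`, on the reduction of
`E` at `p`, on optimality or on the Manin constant):
**every `Ω⁺_f`-normalised modular symbol `[r]⁺_f = ratPlusSymbol f r` is `p`-integral**,
`0 ≤ ord_p [r]⁺_f` (`padicValRat_ratPlusSymbol_nonneg_of_irreducible`), indeed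
`[r]⁺_f ∈ (4(a_ℓ − ℓ − 1))⁻¹ ℤ` for ONE good prime `ℓ ≡ 1 (mod N)` with `p ∤ a_ℓ − ℓ − 1`.  This is
LITERALLY the integrality binder `∀ r, ratPlusSymbol f r ≠ 0 → 0 ≤ padicValRat p (ratPlusSymbol f r)`
("`Ω⁺_f` is an integral period", Kim arXiv:2505.09121 Def. 2.2 / Rem. 2.3) of the cell's
own-currency records `Kim2025.cor17_…_of_integralPeriod_OPEN` (p09 gen 1), now DISCHARGED on every
irreducible row — in particular on all of N11 (`surj(3)`) — by `forall_padicValRat_ratPlusSymbol_nonneg_of_surj`.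
Printed statement: Wuthrich, Doc. Math. 19 (2014) p. 382 ("the only odd primes that can divide these
denominators are those which divide the degree of an isogeny"); Kim, AJM 148 §1.4.1 ("`[r]⁺ ∈ ℤ₍ₚ₎`"
under `ρ̄` irreducible, Manin constant prime to `p`); Greenberg–Vatsal 2000 Rem. 3.4 (ord/mult).
Our proof needs neither the modular parametrisation nor `J₀(N)` nor the Manin constant.

Proof = Drinfeld's proof of the Manin–Drinfeld theorem (1973), made `p`-integral.  Every input is
a tree THEOREM:
1.–2. (sibling file `Additive/EisensteinMultipleEveryCusp.lean`) for a prime `ℓ ≡ 1 (mod N)` every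
   cusp class of `X₀(N)` is fixed by `T_ℓ` (explicit `Γ₀(N)`-matrices + the PROVED Manin relation
   `modularSymbol_gamma0_smul_holds`), so the PROVED Hecke relation `cuspCoeff_mul_modularSymbol`
   (MTT (4.2), any `r`) gives the **Eisenstein multiple `(a_ℓ − ℓ − 1){∞, r}_f ∈ Λ_f` at EVERY cusp**
   (`sub_mul_modularSymbol_mem_periodLattice_of_one_mod`).
3. (`exists_ratPlusSymbol_eq_div_of_forall`, `padicValRat_ratPlusSymbol_nonneg_of_forall`) as
   `re Λ_f = ℤ·Ω⁺_f/2`: `[x]⁺_f = k/(4n₀)`, `n₀ = a_ℓ − ℓ − 1`; `p` odd, `p ∤ n₀` ⇒ `0 ≤ ord_p [x]⁺_f`.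
4. (`padicValRat_ratPlusSymbol_nonneg_of_irreducible`) such an `ℓ` exists when `E[p]` is irreducible
   and `p` is odd: `GaloisImage.exists_prime_one_mod_not_dvd_frobeniusTrace_sub` (relative invariant
   line + T-R18a + Frobenius' density theorem in division form + reduction of torsion), with
   `a_ℓ(f) = a_ℓ(E)` (`cuspCoeff_eq_frobeniusTrace_of_isNewformOf_holds`) and `ℓ ∤ N`
   (`not_dvd_level_of_isNewformOf`).

## References

* V. G. Drinfeld, *Two theorems on modular curves*, Funct. Anal. Appl. 7 (1973) 155–156;
  Ju. I. Manin, *Parabolic points and zeta functions of modular curves*, Izv. 36 (1972), Cor. 3.6.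
  [Manin1972]
* B. Mazur, J. Tate, J. Teitelbaum, Invent. Math. 84 (1986), §I.4 (4.2), §I.8.
  [MazurTateTeitelbaum1986Invent]
* C. Wuthrich, *On the integrality of modular symbols and Kato's Euler system for elliptic curves*,
  Doc. Math. 19 (2014) 381–402, p. 382, Lemma 6, proof of Thm. 4. [Wuthrich2014]
* C.-H. Kim, *The structure of Selmer groups and the Iwasawa main conjecture for elliptic curves*,
  Amer. J. Math. 148 (2026), §1.4.1 [Kim2026AJM]; arXiv:2505.09121 Def. 2.2, Rem. 2.3, §1.4.4
  [Kim2025RefinedTNC].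
* R. Greenberg, V. Vatsal, Invent. Math. 142 (2000), Prop. 3.7, Rem. 3.4. [GreenbergVatsal2000]
* Cell files: `cells/n1011/skel/T-R18b.md`; `cells/n1011/ROUTE-1.md` §15.1 F-d v2, §15.4 R1-8.
-/

noncomputable section

open scoped MatrixGroups ModularForm

open CongruenceSubgroup Literature.NumberTheory.EllipticCurves.ModularForms
  Literature.NumberTheory.EllipticCurves

namespace Summit.BirchSwinnertonDyer.Rank1Residual.Additive

/-! ### From the Eisenstein multiple at every cusp to `p`-integrality of every `[x]⁺_f` -/

section Integrality

variable {N : ℕ} (f : CuspForm (Gamma0 N) 2)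

/-- **Denominators of `[x]⁺` at every cusp**: if `n₀ {∞, y}_f ∈ Λ_f` for ALL `y` (`n₀ ≠ 0`), then
`[x]⁺_f = re plusSymbol(x)/Ω⁺_f = k/(4n₀)` for some `k ∈ ℤ` (`re {∞, ±x} ∈ (Ω⁺/(2n₀))ℤ` as
`re Λ_f = ℤ·Ω⁺/2`; junk case `Ω⁺_f = 0`: `[x]⁺ = 0`). [folklore] -/
theorem exists_normalizedPlusSymbol_eq_div_of_forall {n₀ : ℤ} (hn₀ : n₀ ≠ 0)
    (h : ∀ y : ℚ, (n₀ : ℂ) * modularSymbol f y ∈ periodLattice f) (x : ℚ) :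
    ∃ k : ℤ, normalizedPlusSymbol f x = (k : ℝ) / (4 * n₀) := by
  by_cases hΩ : plusPeriod f = 0
  · exact ⟨0, by rw [normalizedPlusSymbol_eq_zero_of_plusPeriod_eq_zero f hΩ]; simp⟩
  obtain ⟨hre, hpos⟩ := realPeriods_eq_zmultiples_of_plusPeriod_ne_zero f hΩ
  obtain ⟨k₁, hk₁⟩ := exists_re_eq_div_of_intCast_mul_mem f hre hn₀ (h x)
  obtain ⟨k₂, hk₂⟩ := exists_re_eq_div_of_intCast_mul_mem f hre hn₀ (h (-x))
  refine ⟨k₁ + k₂, ?_⟩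
  have hn₀' : (n₀ : ℝ) ≠ 0 := by exact_mod_cast hn₀
  rw [normalizedPlusSymbol, plusSymbol, Complex.div_ofNat_re, Complex.add_re, hk₁, hk₂]
  push_cast
  field_simp
  ring

/-- **The rational plus symbol at every cusp**: under the hypotheses of
`exists_normalizedPlusSymbol_eq_div_of_forall`, `[x]⁺_f = ratPlusSymbol f x = k/(4n₀)` for some
`k ∈ ℤ`. [folklore] -/
theorem exists_ratPlusSymbol_eq_div_of_forall {n₀ : ℤ} (hn₀ : n₀ ≠ 0)
    (h : ∀ y : ℚ, (n₀ : ℂ) * modularSymbol f y ∈ periodLattice f) (x : ℚ) :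
    ∃ k : ℤ, ratPlusSymbol f x = (k : ℚ) / (4 * n₀) := by
  obtain ⟨k, hk⟩ := exists_normalizedPlusSymbol_eq_div_of_forall f hn₀ h x
  have hex : ∃ q : ℚ, (q : ℝ) = normalizedPlusSymbol f x :=
    ⟨(k : ℚ) / (4 * n₀), by rw [hk]; push_cast; rfl⟩
  refine ⟨k, ?_⟩
  rw [ratPlusSymbol, dif_pos hex]
  apply Rat.cast_injective (α := ℝ)
  rw [hex.choose_spec, hk]
  push_cast
  rfl

/-- **`p`-integrality of every `[x]⁺_f`, norm form**: if moreover `p` is odd and `p ∤ n₀` then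
`‖[x]⁺_f‖_p ≤ 1`. [folklore] -/
theorem norm_ratPlusSymbol_le_one_of_forall {p : ℕ} [Fact p.Prime] (hp2 : p ≠ 2) {n₀ : ℤ}
    (hpn₀ : ¬ (p : ℤ) ∣ n₀) (h : ∀ y : ℚ, (n₀ : ℂ) * modularSymbol f y ∈ periodLattice f) (x : ℚ) :
    ‖((ratPlusSymbol f x : ℚ) : ℚ_[p])‖ ≤ 1 := by
  have hp : p.Prime := Fact.out
  have hn₀ : n₀ ≠ 0 := by rintro rfl; exact hpn₀ (dvd_zero _)
  obtain ⟨k, hk⟩ := exists_ratPlusSymbol_eq_div_of_forall f hn₀ h x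
  have h4 : ‖((4 : ℤ) : ℚ_[p])‖ = 1 := by
    refine le_antisymm (Padic.norm_int_le_one _) (not_lt.mp fun hlt ↦ ?_)
    have hdvd : (p : ℤ) ∣ 4 := Padic.norm_intCast_lt_one_iff.mp hlt
    have hp4 : p ∣ 2 ^ 2 := by exact_mod_cast hdvd
    exact hp2 ((Nat.prime_dvd_prime_iff_eq hp Nat.prime_two).mp (hp.dvd_of_dvd_pow hp4))
  have hn : ‖((n₀ : ℤ) : ℚ_[p])‖ = 1 :=
    le_antisymm (Padic.norm_int_le_one _)
      (not_lt.mp fun hlt ↦ hpn₀ (Padic.norm_intCast_lt_one_iff.mp hlt))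
  rw [hk]
  push_cast
  rw [norm_div, norm_mul, show ((4 : ℚ_[p])) = ((4 : ℤ) : ℚ_[p]) by norm_cast, h4, hn, mul_one,
    div_one]
  exact Padic.norm_int_le_one k

/-- **`p`-integrality of every `[x]⁺_f`, valuation form**: if `p` is odd, `p ∤ n₀`, and
`n₀ {∞, y}_f ∈ Λ_f` for all `y`, then `0 ≤ ord_p [x]⁺_f` whenever `[x]⁺_f ≠ 0`
(`ord_p (k/(4n₀)) = ord_p k ≥ 0`). [folklore] -/
theorem padicValRat_ratPlusSymbol_nonneg_of_forall {p : ℕ} [Fact p.Prime] (hp2 : p ≠ 2) {n₀ : ℤ}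
    (hpn₀ : ¬ (p : ℤ) ∣ n₀) (h : ∀ y : ℚ, (n₀ : ℂ) * modularSymbol f y ∈ periodLattice f) (x : ℚ)
    (hx : ratPlusSymbol f x ≠ 0) : 0 ≤ padicValRat p (ratPlusSymbol f x) := by
  have hp : p.Prime := Fact.out
  have hn₀ : n₀ ≠ 0 := by rintro rfl; exact hpn₀ (dvd_zero _)
  obtain ⟨k, hk⟩ := exists_ratPlusSymbol_eq_div_of_forall f hn₀ h x
  have hk0 : (k : ℚ) ≠ 0 := by
    intro h0
    rw [hk, h0, zero_div] at hx
    exact hx rfl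
  have h4n : ((4 * n₀ : ℤ) : ℚ) ≠ 0 := by
    have : (4 : ℤ) * n₀ ≠ 0 := mul_ne_zero (by norm_num) hn₀
    exact_mod_cast this
  have hp4 : ¬ (p : ℤ) ∣ 4 := by
    intro hdvd
    have hp4 : p ∣ 2 ^ 2 := by exact_mod_cast hdvd
    exact hp2 ((Nat.prime_dvd_prime_iff_eq hp Nat.prime_two).mp (hp.dvd_of_dvd_pow hp4))
  have hval : padicValRat p (((4 * n₀ : ℤ)) : ℚ) = 0 := by
    rw [padicValRat.of_int, padicValInt.eq_zero_of_not_dvd]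
    · rfl
    · exact fun hdvd ↦ ((Nat.prime_iff_prime_int.mp hp).dvd_or_dvd hdvd).elim hp4 hpn₀
  rw [hk, show ((k : ℚ) / (4 * n₀)) = (k : ℚ) / ((4 * n₀ : ℤ) : ℚ) by push_cast; rfl,
    padicValRat.div hk0 h4n, hval, sub_zero, padicValRat.of_int]
  exact_mod_cast Nat.zero_le _

end Integrality

/-! ### Assembly: `p` odd, `E[p]` irreducible ⇒ every `[r]⁺_f` is `p`-integral -/

section Assembly

variable {N : ℕ} [NeZero N] {f : CuspForm (Gamma0 N) 2} {p : ℕ} [Fact p.Prime]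
  {W : WeierstrassCurve ℚ} [W.IsElliptic] [W.IsGloballyMinimal]

/-- **An Eisenstein multiple prime to `p` at EVERY cusp, from irreducibility of `E[p]` (`p` odd).**
If `f` is the newform of `E = W/ℚ`, `p` is odd and `E[p]` is irreducible, there is an integer `n₀`
prime to `p` with `n₀ {∞, y}_f ∈ Λ_f` for ALL `y ∈ ℚ`: `n₀ = a_ℓ(E) − ℓ − 1` for a good prime
`ℓ ≡ 1 (mod N)` with `p ∤ a_ℓ − ℓ − 1` (`GaloisImage.exists_prime_one_mod_not_dvd_frobeniusTrace_sub`),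
`a_ℓ(f) = a_ℓ(E)` (`cuspCoeff_eq_frobeniusTrace_of_isNewformOf_holds`), and
`sub_mul_modularSymbol_mem_periodLattice_of_one_mod`. [folklore] -/
theorem exists_intCast_mul_modularSymbol_mem_forall (hp2 : p ≠ 2) (hf : IsNewformOf W f)
    (hirr : W.HasIrreducibleModPGaloisRep p) :
    ∃ n₀ : ℤ, ¬ (p : ℤ) ∣ n₀ ∧ ∀ y : ℚ, (n₀ : ℂ) * modularSymbol f y ∈ periodLattice f := by
  obtain ⟨ℓ, hℓ, -, -, hgood, hN, hndvd⟩ :=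
    GaloisImage.exists_prime_one_mod_not_dvd_frobeniusTrace_sub W p hp2 hirr N ∅ Set.finite_empty
  have hap : cuspCoeff f ℓ = ((W.frobeniusTrace ℓ : ℤ) : ℂ) :=
    cuspCoeff_eq_frobeniusTrace_of_isNewformOf_holds hf hgood
  refine ⟨W.frobeniusTrace ℓ - (ℓ + 1), hndvd, fun y ↦ ?_⟩
  have h := sub_mul_modularSymbol_mem_periodLattice_of_one_mod hf.1 hℓ.out hN y
  rw [hap] at h
  push_cast
  convert h using 2
  ring

/-- **`p` odd, `E[p]` irreducible ⇒ every modular symbol `[r]⁺_f` of the newform `f` of `E` is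
`p`-integral** (ROUTE-1 R1-8 (ii) / F-d v2 (iii) as a kernel theorem; printed: Wuthrich 2014 p. 382,
Kim AJM 148 §1.4.1, Greenberg–Vatsal 2000 Rem. 3.4): for `r ∈ ℚ` with `[r]⁺_f ≠ 0`,
`0 ≤ ord_p [r]⁺_f`.  This is the binder
`∀ r, ratPlusSymbol f r ≠ 0 → 0 ≤ padicValRat p (ratPlusSymbol f r)` ("`Ω⁺_f` is an integral
period", Kim 2025 Def. 2.2) of the cell's `Kim2025.cor17_…_of_integralPeriod_OPEN` records, on every
irreducible row; no hypothesis on `N`, the reduction type, optimality or the Manin constant.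
[folklore] -/
theorem padicValRat_ratPlusSymbol_nonneg_of_irreducible (hp2 : p ≠ 2) (hf : IsNewformOf W f)
    (hirr : W.HasIrreducibleModPGaloisRep p) (r : ℚ) (hr : ratPlusSymbol f r ≠ 0) :
    0 ≤ padicValRat p (ratPlusSymbol f r) := by
  obtain ⟨n₀, hpn₀, h⟩ := exists_intCast_mul_modularSymbol_mem_forall hp2 hf hirr
  exact padicValRat_ratPlusSymbol_nonneg_of_forall f hp2 hpn₀ h r hr

/-- Norm form: `‖[r]⁺_f‖_p ≤ 1` for every `r` (`p` odd, `E[p]` irreducible, `f` the newform of `E`).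
[folklore] -/
theorem norm_ratPlusSymbol_le_one_of_irreducible (hp2 : p ≠ 2) (hf : IsNewformOf W f)
    (hirr : W.HasIrreducibleModPGaloisRep p) (r : ℚ) :
    ‖((ratPlusSymbol f r : ℚ) : ℚ_[p])‖ ≤ 1 := by
  obtain ⟨n₀, hpn₀, h⟩ := exists_intCast_mul_modularSymbol_mem_forall hp2 hf hirr
  exact norm_ratPlusSymbol_le_one_of_forall f hp2 hpn₀ h r

/-- **The integrality binder of the `Kim2025.…_of_integralPeriod_OPEN` records, discharged on every
irreducible row**: `∀ r, [r]⁺_f ≠ 0 → 0 ≤ ord_p [r]⁺_f`. [folklore] -/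
theorem forall_padicValRat_ratPlusSymbol_nonneg_of_irreducible (hp2 : p ≠ 2) (hf : IsNewformOf W f)
    (hirr : W.HasIrreducibleModPGaloisRep p) :
    ∀ r : ℚ, ratPlusSymbol f r ≠ 0 → 0 ≤ padicValRat p (ratPlusSymbol f r) :=
  padicValRat_ratPlusSymbol_nonneg_of_irreducible hp2 hf hirr

/-- Row reading under `surj(p)`, `p` odd (every N11 / tower row): surjective mod-`p` image ⇒
irreducible ⇒ `∀ r, [r]⁺_f ≠ 0 → 0 ≤ ord_p [r]⁺_f`. [folklore] -/
theorem forall_padicValRat_ratPlusSymbol_nonneg_of_surj (hp2 : p ≠ 2) (hf : IsNewformOf W f)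
    (hsurj : W.HasSurjectiveModNGaloisRep p) :
    ∀ r : ℚ, ratPlusSymbol f r ≠ 0 → 0 ≤ padicValRat p (ratPlusSymbol f r) :=
  padicValRat_ratPlusSymbol_nonneg_of_irreducible hp2 hf
    (hasIrreducibleModPGaloisRep_of_hasSurjectiveModNGaloisRep W p hsurj)

/-- Row reading under the tower hypothesis `∀ n, surj(p^n)` of the `Kim2025` records (use `n = 1`).
[folklore] -/
theorem forall_padicValRat_ratPlusSymbol_nonneg_of_towerSurj (hp2 : p ≠ 2) (hf : IsNewformOf W f)
    (hsurj : ∀ n : ℕ, W.HasSurjectiveModNGaloisRep (p ^ n : ℕ)) :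
    ∀ r : ℚ, ratPlusSymbol f r ≠ 0 → 0 ≤ padicValRat p (ratPlusSymbol f r) :=
  forall_padicValRat_ratPlusSymbol_nonneg_of_surj hp2 hf (by simpa using hsurj 1)

end Assembly

end Summit.BirchSwinnertonDyer.Rank1Residual.Additive

end
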